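/-
Copyright (c) 2026 the pub-hodgecm-mathlib formalisation cell (harness21).  Prover seat hodgecm-mathlib-A-p03 (g26); road «R1LL-tree» (architect A-p16 (g27∕g28), RULINGS A-23 (b),
A-25 (a)–(c); LEAD F0P3a-plan (g10)), brick (R5b-α-VERTEX) FILE V2b «the signed depth expansion at the VERTEX stabiliser K♯», 2026-09-01.
-/
import Literature.NumberTheory.Automorphic.UnitaryRankTwoDepthValueLawRamifiedModular   -- ★-to-be A-p03 V2a: vertex value law at `K♯`, `formCongr σ D J₀ = (−ϖ)•J♯`
import Literature.NumberTheory.Automorphic.UnitaryRankTwoSignedNormalFormElementsModular  -- ★ B-p12 (g29) p843801: `exists_conj_signedNormalForm_elements_modular`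
import Literature.NumberTheory.Automorphic.UnitaryRankTwoDepthExpansionRamified        -- ★ A-p13 (g32) α2 (EDGE twin; binder template) + its imports (R2-C, L1, (H3) bookkeeping)
import HarnessLib

/-!
# (R5b-α-VERTEX) FILE V2b — THE ONE-PLACE SIGNED DEPTH EXPANSION of `Σ_{q ∈ Fix_γ(U⧸K♯)} φ(q.out⁻¹ γ q.out)` at a TAMELY RAMIFIED place, VERTEX piece
# (`K♯ = U(J₀) ∩ D GL₂(𝒪) D⁻¹`, `D = diag(1, ϖ)`, `σϖ = −ϖ`; `ϖ`-modular lattices = the type-`1` vertices of the tree): weights `#B_i(N) = 2q^{(N−i)∕2}` on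
# `i ≡ N + 1 (2)`, SIGNED value points `u₁(1 + ϖ^i · D[[0, η^{e_i}],[0,0]]D⁻¹)` at EVEN `i`
(Labesse–Langlands 1979 §2 Lemma 2.1, `δ_m = 2q^m`; Rogawski 1990 §4.9 Lemma 4.9.3; Kottwitz 1988 §2 — road «R1LL-tree», architect A-p16 (g27) RULING A-23 (b), A-p16 (g28)
RULING A-25; designer of record B-p12 (g29) (memo ba95cded; 10:33:18Z; 10:52:58Z); EDGE twin ★ A-p13 (g32) α2 `finsum_fixedBy_conj_eq_signedDepthExpansion_ramified`.)

Topic `NumberTheory/Automorphic`; namespace `Literature.NumberTheory.Automorphic`.  THEOREMS ONLY (no definition, no instance, no notation, no named fact, no `sorry`).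
Cell `pub/hodgecm-mathlib` (D-0151), crux H413 = `stmt-HodgeConjecture-24833`, residue `RankOneUnstableTransferNonsplitCMERamified` of #159 (R-5b END brick; V3∕PAIR dress
F0P3-p01 (g14), END F0P3a-p03 (g12)).  HONEST LABEL: HC_CM is proved only modulo the printed citations (hLiu418, h413) until rung 0 closes; this is lattice∕coset
bookkeeping over a complete DVR with a tamely ramified involution and asserts nothing printed.

THE STATEMENT = ★ α2's with: cosets `U ⧸ K♯`, `K♯ := ((glInt 2 F).map (MulAut.conj D)).subgroupOf U`; the VERTEX DOCKING `hB` («every `ϖ`-modular frame factors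
`g = y·D·k`», true at the completions of a number field — ★ A-p03 p843555 `exists_mem_unitaryGroupOfForm_mul_glDiagonal_mul_of_modular_of_ramified` — taken as a
hypothesis here); the CONJUGATED level law `hKm` (level `m` of `D⁻¹yD`); `φ` invariant under `Ad K♯` and right-`Km`.  CONCLUSION: bits `e i ≤ 1` characterised for EVEN
`i < m` by `e i = 0 ⟺ (−1)^{(N+i+1)∕2+1}·u₁·((u₀−u₁)ϖ^{−N})·(−h₀)` has square residue, scalar point `xm = u₁·1`, window points
`x i = u₁(1 + ϖ^i · D[[0, η^{e i}],[0,0]]D⁻¹)` (even `i`), and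
`Σᶠ_{q ∈ Fix_γ(U⧸K♯)} φ(q.out⁻¹ γ q.out) = (Σ_{j ≤ N, j odd, j + m ≤ N} m_q(j)) • φ xm + Σ_{i<m} [i ≤ N ∧ (N − i) odd]·m_q(N − i) • φ (x i)`, `m_q(j) = 2q^{⌊j∕2⌋}`.
ROUTE = ★ α2 verbatim at `k♯ := D⁻¹(q.out⁻¹ γ q.out)D`: ★ (α) L1 regrouping by `min (depth q) m`; the VALUE LAW ★-to-be V2a `apply_eq_apply_scalar_of_depth_le_conj` ∕
`apply_eq_apply_signedNormalForm_of_depth_eq_ramified_modular` (eigenline `col₀((q.out·D)⁻¹P)`, `ϖ·θ♯ = −h₀` from `formCongr σ D J₀ = (−ϖ)•J♯`); the COUNTS through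
★ V1 `ncard_sep_fixedBy_conj_unitary_eq_ncard_modular` + ★ token bridge `setOf_modularStable_and_eq_selfDualStable_and` (`ϖ•J' = ᵗσ(g)J₀g ⟺ J' = ᵗσ(g)(ϖ⁻¹J₀)g`) + ★ `ncard_selfDualStable_level_congr` + ★ lattice token
`map_sub_smul_one_le_iff_forall_mem` + ★ A-p01 R2-C `ncard_selfDualStable_zpow_smul_diagonal_level_eq_sum` at `d := 1`; elements ★ B-p12 p843801.

## References
* [LabesseLanglands1979] J.-P. Labesse, R. P. Langlands, *L-indistinguishability for SL(2)*, Canad. J. Math. 31 (1979), §2 Lemma 2.1 pp. 8–9.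
* [Rogawski1990] J. D. Rogawski, *Automorphic Representations of Unitary Groups in Three Variables* (1990), §4.9 Lemma 4.9.3 p. 56.
* [Kottwitz1988] R. E. Kottwitz, *Tamagawa numbers*, Ann. of Math. 127 (1988), §2.  [Jacobowitz1962] R. Jacobowitz, *Hermitian forms over local fields*, §8.
-/

set_option autoImplicit false

noncomputable section

open scoped ValuativeRel Matrix MatrixGroups
open Matrix ValuativeRel Finset MulAction

namespace Literature.NumberTheory.Automorphic

variable {F : Type*} [Field F] [ValuativeRel F]

/-! ## §0 Bookkeeping -/

section Bookkeeping

/-- Parity bits are unique: two `e, e' ≤ 1` characterised by the same proposition agree. [cite: Rogawski1990, §4.9 p. 54] -/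
private theorem eq_of_iff_eq_zero_of_le_one_vtx {X : Prop} {e e' : ℕ} (he : e ≤ 1) (he' : e' ≤ 1) (h : e = 0 ↔ X) (h' : e' = 0 ↔ X) : e' = e := by
  rcases Nat.le_one_iff_eq_zero_or_eq_one.1 he with rfl | rfl <;> rcases Nat.le_one_iff_eq_zero_or_eq_one.1 he' with rfl | rfl
  · rfl
  · exact absurd (h'.2 (h.1 rfl)) one_ne_zero
  · exact absurd (h.2 (h'.1 rfl)) one_ne_zero
  · rfl

omit [ValuativeRel F] in
/-- `diagonal u = [[u₀, 0],[0, u₁]]`. [cite: Jacobowitz1962, §4] -/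
private theorem diagonal_fin_two_eq_vtx (u : Fin 2 → F) : (diagonal u : Matrix (Fin 2) (Fin 2) F) = !![u 0, 0; 0, u 1] := by
  ext i j; fin_cases i <;> fin_cases j <;> simp

/-- `|a − c| = |ϖ^N|` ⇒ `(a − c)ϖ^{−N}` is a unit (as a valuation statement). [cite: Rogawski1990, §4.9 p. 55] -/
private theorem valuation_sub_mul_inv_pow_eq_one_vtx {ϖ : F} (hϖ : IsUniformizingElement ϖ) {a c : F} {N : ℕ} (hN : valuation F (a - c) = valuation F (ϖ ^ N)) :
    valuation F ((a - c) * (ϖ ^ N)⁻¹) = 1 := by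
  have hϖN1 : valuation F (ϖ ^ N) ≠ 0 := (Valuation.ne_zero_iff _).2 (pow_ne_zero _ hϖ.ne_zero)
  rw [map_mul, map_inv₀, hN, mul_inv_cancel₀ hϖN1]

variable (σ : F →+* F) {ϖ : F}

/-- **`ᵗσ(D) J₀ D ∈ ϖ·GL₂(𝒪)`** for `D = diag(1, ϖ)`, `σϖ = −ϖ`: the witness is `J' = [[0,1],[−1,0]]` (`ϖ • J' = (−ϖ) • J♯`). [cite: Jacobowitz1962, §8] [cite: Kottwitz1988, §2] -/
theorem exists_mem_glInt_smul_coe_eq_formCongr_diag (D : GL (Fin 2) F) (hD : (D : Matrix (Fin 2) (Fin 2) F) = !![1, 0; 0, ϖ]) (hσϖ : σ ϖ = -ϖ) :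
    ∃ J' ∈ glInt 2 F, ϖ • (J' : Matrix (Fin 2) (Fin 2) F) = formCongr σ D (!![0, 1; 1, 0] : Matrix (Fin 2) (Fin 2) F) := by
  refine ⟨⟨!![0, 1; -1, 0], !![0, -1; 1, 0], sharp'_mul_sharp_eq_one, mul_eq_one_comm.1 sharp'_mul_sharp_eq_one⟩, (mem_glInt_iff _).2 ⟨?_, ?_⟩, ?_⟩
  · intro r s; fin_cases r <;> fin_cases s <;> simp
  · intro r s; fin_cases r <;> fin_cases s <;> simp
  · rw [formCongr_diag_eq_neg_smul_sharp σ D hD hσϖ]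
    ext r s; fin_cases r <;> fin_cases s <;> simp

end Bookkeeping

/-! ## §1 The signed depth expansion, vertex piece -/

section Expansion

variable (σ : F →+* F) {ϖ : F} (hϖ : IsUniformizingElement ϖ) (hσϖ : σ ϖ = -ϖ)
  (σO : 𝒪[F] →+* 𝒪[F]) (hσO : ∀ x : 𝒪[F], ((σO x : 𝒪[F]) : F) = σ x) (hσσ : ∀ x, σO (σO x) = x)

-- the statement and the coset∕lattice identities cost several times the default ELABORATION budget (no search, no `decide`), as for ★ (H3)∕(H4)∕α2;
-- the `MulAction ↥U (↥U ⧸ K♯)` instance search through the mapped subgroup needs the larger synthesis budget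
set_option maxHeartbeats 1600000 in
set_option synthInstance.maxHeartbeats 200000 in
include hϖ hσϖ hσO hσσ in
/-- **(R5b-α-VERTEX) THE SIGNED DEPTH EXPANSION AT A TAMELY RAMIFIED PLACE, VERTEX PIECE `K♯ = U ∩ D GL₂(𝒪) D⁻¹`.**  See the module docstring.
[cite: LabesseLanglands1979, §2 Lemma 2.1 pp. 8–9] [cite: Rogawski1990, §4.9 Lemma 4.9.3 p. 56] [cite: Kottwitz1988, §2] -/
theorem finsum_fixedBy_conj_eq_signedDepthExpansion_ramified_modular
    [IsAdicComplete (IsLocalRing.maximalIdeal 𝒪[F]) 𝒪[F]] [IsDiscreteValuationRing 𝒪[F]] [Finite (IsLocalRing.ResidueField 𝒪[F])]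
    (h2 : IsUnit (2 : 𝒪[F])) (hres : ∀ x : 𝒪[F], σO x - x ∈ IsLocalRing.maximalIdeal 𝒪[F])
    {η : 𝒪[F]} (hηu : IsUnit η) (hση : σO η = η) (hη : ¬ IsSquare (IsLocalRing.residue 𝒪[F] η))
    {q : ℕ} (hq : Nat.card (IsLocalRing.ResidueField 𝒪[F]) = q)
    (J : GL (Fin 2) F) (hJ : (J : Matrix (Fin 2) (Fin 2) F) = !![0, 1; 1, 0])
    (D : GL (Fin 2) F) (hD : (D : Matrix (Fin 2) (Fin 2) F) = !![1, 0; 0, ϖ])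
    {γ : ↥(unitaryGroupOfForm σ (J : Matrix (Fin 2) (Fin 2) F))} {P : GL (Fin 2) F} {u : Fin 2 → F}
    (hP : (((γ : ↥(unitaryGroupOfForm σ (J : Matrix (Fin 2) (Fin 2) F))) : GL (Fin 2) F) : Matrix (Fin 2) (Fin 2) F) * (P : Matrix (Fin 2) (Fin 2) F) = (P : Matrix (Fin 2) (Fin 2) F) * diagonal u) (hu : Function.Injective u)
    (hu1 : ∀ i, σ (u i) * u i = 1) (hu1v : ∀ i, valuation F (u i) = 1)
    {N : ℕ} (hN : valuation F (u 0 - u 1) = valuation F (ϖ ^ N))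
    {h : Fin 2 → F} (hPh : formCongr σ P (J : Matrix (Fin 2) (Fin 2) F) = Matrix.diagonal h)
    (hh0 : valuation F (h 0) = 1) (hh1 : valuation F (h 1) = 1) (hσh : ∀ i, σ (h i) = h i)
    (r : 𝒪[F]) (hr : h 0 * (r : F) = -h 1) (hsq : IsSquare (IsLocalRing.residue 𝒪[F] r))
    -- the VERTEX docking: every `ϖ`-modular frame factors `g = y·D·k` ((hB) — ★ A-p06 ∕ ★ A-p03 p843555 at a number-field place)
    (hB : ∀ g : GL (Fin 2) F, (∃ J' ∈ glInt 2 F, ϖ • (J' : Matrix (Fin 2) (Fin 2) F) = formCongr σ g (J : Matrix (Fin 2) (Fin 2) F)) →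
      ∃ y ∈ unitaryGroupOfForm σ (J : Matrix (Fin 2) (Fin 2) F), ∃ k ∈ glInt 2 F, g = y * D * k)
    (hfin : (MulAction.fixedBy (↥(unitaryGroupOfForm σ (J : Matrix (Fin 2) (Fin 2) F)) ⧸
      ((glInt 2 F).map (MulAut.conj D).toMonoidHom).subgroupOf (unitaryGroupOfForm σ (J : Matrix (Fin 2) (Fin 2) F))) γ).Finite)
    {m : ℕ} (hmN : m ≤ N) (Km : Subgroup ↥(unitaryGroupOfForm σ (J : Matrix (Fin 2) (Fin 2) F)))
    -- the CONJUGATED level law at `K♯` (★ (H4) p843541 shape): level `m` of `D⁻¹ y D`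
    (hKm : ∀ y : ↥(unitaryGroupOfForm σ (J : Matrix (Fin 2) (Fin 2) F)),
      (∀ r s, ϖ ^ (-(m : ℤ)) * ((((D⁻¹ * (y : GL (Fin 2) F) * D : GL (Fin 2) F)) : Matrix (Fin 2) (Fin 2) F) - 1) r s ∈ 𝒪[F]) → y ∈ Km)
    {E : Type*} [AddCommMonoid E] (φ : ↥(unitaryGroupOfForm σ (J : Matrix (Fin 2) (Fin 2) F)) → E)
    (hφAd : ∀ k ∈ ((glInt 2 F).map (MulAut.conj D).toMonoidHom).subgroupOf (unitaryGroupOfForm σ (J : Matrix (Fin 2) (Fin 2) F)), ∀ x, φ (k * x * k⁻¹) = φ x)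
    (hφm : ∀ x, ∀ y ∈ Km, φ (x * y) = φ x) :
    ∃ (e : ℕ → ℕ) (xm : ↥(unitaryGroupOfForm σ (J : Matrix (Fin 2) (Fin 2) F))) (x : ℕ → ↥(unitaryGroupOfForm σ (J : Matrix (Fin 2) (Fin 2) F))), (∀ i, e i ≤ 1) ∧
      (∀ i < m, Even i → ∀ S : 𝒪[F], (S : F) = (-1) ^ ((N + i + 1) / 2 + 1) * u 1 * ((u 0 - u 1) * (ϖ ^ N)⁻¹) * (-h 0) →
        (e i = 0 ↔ IsSquare (IsLocalRing.residue 𝒪[F] S))) ∧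
      (((xm : ↥(unitaryGroupOfForm σ (J : Matrix (Fin 2) (Fin 2) F))) : GL (Fin 2) F) : Matrix (Fin 2) (Fin 2) F) = u 1 • (1 : Matrix (Fin 2) (Fin 2) F) ∧
      (∀ i, Even i → (((x i : ↥(unitaryGroupOfForm σ (J : Matrix (Fin 2) (Fin 2) F))) : GL (Fin 2) F) : Matrix (Fin 2) (Fin 2) F) =
        u 1 • ((1 : Matrix (Fin 2) (Fin 2) F) + ϖ ^ i • ((D : Matrix (Fin 2) (Fin 2) F) * !![0, ((η : 𝒪[F]) : F) ^ (e i); 0, 0] * ((D⁻¹ : GL (Fin 2) F) : Matrix (Fin 2) (Fin 2) F)))) ∧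
      ∑ᶠ t ∈ MulAction.fixedBy (↥(unitaryGroupOfForm σ (J : Matrix (Fin 2) (Fin 2) F)) ⧸
          ((glInt 2 F).map (MulAut.conj D).toMonoidHom).subgroupOf (unitaryGroupOfForm σ (J : Matrix (Fin 2) (Fin 2) F))) γ, φ (t.out⁻¹ * γ * t.out) =
        (∑ j ∈ (range (N + 1)).filter (fun j => j % 2 = 1 ∧ j + m ≤ N), (if j = 0 then 1 else 2 * q ^ (j / 2))) • φ xm +
          ∑ i ∈ range m, (if i ≤ N ∧ (N - i) % 2 = 1 then (if N - i = 0 then 1 else 2 * q ^ ((N - i) / 2)) else 0) • φ (x i) := by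
  classical
  -- §a scalars
  have hϖ0 : ϖ ≠ 0 := hϖ.ne_zero
  have hc0 : u 1 ≠ 0 := fun h0 => by have := hu1v 1; rw [h0, map_zero] at this; exact zero_ne_one this
  have hu1O : u 1 ∈ 𝒪[F] := (Valuation.mem_integer_iff _ _).2 (hu1v 1).le
  have hh0O : h 0 ∈ 𝒪[F] := (Valuation.mem_integer_iff _ _).2 hh0.le
  have hw1 : valuation F ((u 0 - u 1) * (ϖ ^ N)⁻¹) = 1 := valuation_sub_mul_inv_pow_eq_one_vtx hϖ hN
  have hwO : (u 0 - u 1) * (ϖ ^ N)⁻¹ ∈ 𝒪[F] := (Valuation.mem_integer_iff _ _).2 hw1.le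
  have hwdec : u 0 - u 1 = ϖ ^ N * ((u 0 - u 1) * (ϖ ^ N)⁻¹) := by rw [mul_comm, inv_mul_cancel_right₀ (pow_ne_zero _ hϖ0)]
  have hηO : ((η : 𝒪[F]) : F) ∈ 𝒪[F] := η.2
  have hση' : σ ((η : 𝒪[F]) : F) = ((η : 𝒪[F]) : F) := by rw [← hσO, hση]
  have h01 : u 0 ≠ u 1 := fun h01 => absurd (hu h01) (by decide)
  -- the conjugate attached to a coset, as a `GL₂` conjugate by `t.out · D`
  have hconjGL : ∀ t : ↥(unitaryGroupOfForm σ (J : Matrix (Fin 2) (Fin 2) F)) ⧸ ((glInt 2 F).map (MulAut.conj D).toMonoidHom).subgroupOf (unitaryGroupOfForm σ (J : Matrix (Fin 2) (Fin 2) F)),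
      D⁻¹ * ((t.out⁻¹ * γ * t.out : ↥(unitaryGroupOfForm σ (J : Matrix (Fin 2) (Fin 2) F))) : GL (Fin 2) F) * D =
        ((t.out : GL (Fin 2) F) * D)⁻¹ * (γ : GL (Fin 2) F) * ((t.out : GL (Fin 2) F) * D) := by
    intro t
    rw [Subgroup.coe_mul, Subgroup.coe_mul, Subgroup.coe_inv, _root_.mul_inv_rev]
    group
  -- §b the sign data `S i ∈ 𝒪` and the bits `e i`
  have hSO : ∀ i : ℕ, (-1 : F) ^ ((N + i + 1) / 2 + 1) * u 1 * ((u 0 - u 1) * (ϖ ^ N)⁻¹) * (-h 0) ∈ 𝒪[F] :=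
    fun i => mul_mem (mul_mem (mul_mem (pow_mem (neg_mem (one_mem _)) _) hu1O) hwO) (neg_mem hh0O)
  let S : ℕ → 𝒪[F] := fun i => ⟨_, hSO i⟩
  let e : ℕ → ℕ := fun i => if IsSquare (IsLocalRing.residue 𝒪[F] (S i)) then 0 else 1
  have he1 : ∀ i, e i ≤ 1 := fun i => by simp only [e]; split_ifs <;> omega
  have hechar : ∀ i, (e i = 0 ↔ IsSquare (IsLocalRing.residue 𝒪[F] (S i))) := fun i => by
    simp only [e]; split_ifs with hsq' <;> simp [hsq']
  have hechar' : ∀ i, ∀ S' : 𝒪[F], (S' : F) = (-1) ^ ((N + i + 1) / 2 + 1) * u 1 * ((u 0 - u 1) * (ϖ ^ N)⁻¹) * (-h 0) →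
      (e i = 0 ↔ IsSquare (IsLocalRing.residue 𝒪[F] S')) := by
    intro i S' hS'
    have : S' = S i := Subtype.ext hS'
    rw [this]; exact hechar i
  -- §c the conjugated signed normal-form elements (★ B-p12 p843801) and the window points `x i := x' i (e i)`
  obtain ⟨xm, x', -, -, hxm, hxm', hx, hx''⟩ :=
    exists_conj_signedNormalForm_elements_modular σ (J : Matrix (Fin 2) (Fin 2) F) hJ D hD (hu1 1) (hu1v 1) hσϖ hϖ.mem hση' hηO
  refine ⟨e, xm, fun i => x' i (e i), he1, fun i _ hi S' hS' => hechar' i S' hS', hxm, fun i hi => hx i (e i) hi, ?_⟩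
  -- §d the depth predicate of a coset (on `k♯ := D⁻¹ (t.out⁻¹ γ t.out) D`) and its bookkeeping
  have hanti : ∀ t : ↥(unitaryGroupOfForm σ (J : Matrix (Fin 2) (Fin 2) F)) ⧸ ((glInt 2 F).map (MulAut.conj D).toMonoidHom).subgroupOf (unitaryGroupOfForm σ (J : Matrix (Fin 2) (Fin 2) F)), ∀ i j : ℕ, i ≤ j →
      (∀ r s, ϖ ^ (-((j : ℕ) : ℤ)) * ((((D⁻¹ * ((t.out⁻¹ * γ * t.out : ↥(unitaryGroupOfForm σ (J : Matrix (Fin 2) (Fin 2) F))) : GL (Fin 2) F) * D : GL (Fin 2) F)) : Matrix (Fin 2) (Fin 2) F) - u 1 • (1 : Matrix (Fin 2) (Fin 2) F)) r s ∈ 𝒪[F]) →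
      (∀ r s, ϖ ^ (-((i : ℕ) : ℤ)) * ((((D⁻¹ * ((t.out⁻¹ * γ * t.out : ↥(unitaryGroupOfForm σ (J : Matrix (Fin 2) (Fin 2) F))) : GL (Fin 2) F) * D : GL (Fin 2) F)) : Matrix (Fin 2) (Fin 2) F) - u 1 • (1 : Matrix (Fin 2) (Fin 2) F)) r s ∈ 𝒪[F]) :=
    fun t i j hij hij' => depthPred_anti hϖ _ hij hij'
  have hkI : ∀ t ∈ MulAction.fixedBy (↥(unitaryGroupOfForm σ (J : Matrix (Fin 2) (Fin 2) F)) ⧸ ((glInt 2 F).map (MulAut.conj D).toMonoidHom).subgroupOf (unitaryGroupOfForm σ (J : Matrix (Fin 2) (Fin 2) F))) γ,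
      D⁻¹ * ((t.out⁻¹ * γ * t.out : ↥(unitaryGroupOfForm σ (J : Matrix (Fin 2) (Fin 2) F))) : GL (Fin 2) F) * D ∈ glInt 2 F := fun t ht =>
    coe_conj_out_mem_glInt_of_mem_fixedBy_conj σ J D γ t ht
  have h0 : ∀ t ∈ MulAction.fixedBy (↥(unitaryGroupOfForm σ (J : Matrix (Fin 2) (Fin 2) F)) ⧸ ((glInt 2 F).map (MulAut.conj D).toMonoidHom).subgroupOf (unitaryGroupOfForm σ (J : Matrix (Fin 2) (Fin 2) F))) γ,
      (∀ r s, ϖ ^ (-((0 : ℕ) : ℤ)) * ((((D⁻¹ * ((t.out⁻¹ * γ * t.out : ↥(unitaryGroupOfForm σ (J : Matrix (Fin 2) (Fin 2) F))) : GL (Fin 2) F) * D : GL (Fin 2) F)) : Matrix (Fin 2) (Fin 2) F) - u 1 • (1 : Matrix (Fin 2) (Fin 2) F)) r s ∈ 𝒪[F]) := fun t ht r s => by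
    have hkO := ((mem_glInt_iff _).1 (hkI t ht)).1
    simpa only [Nat.cast_zero, neg_zero, zpow_zero] using depthPred_zero hkO hu1O r s
  -- §e THE VALUE LAW at every fixed coset
  have hvalue : ∀ t ∈ MulAction.fixedBy (↥(unitaryGroupOfForm σ (J : Matrix (Fin 2) (Fin 2) F)) ⧸ ((glInt 2 F).map (MulAut.conj D).toMonoidHom).subgroupOf (unitaryGroupOfForm σ (J : Matrix (Fin 2) (Fin 2) F))) γ, φ (t.out⁻¹ * γ * t.out) =
        (fun j : ℕ => if j = m then φ xm else φ (x' j (e j)))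
          (min (Nat.findGreatest (fun i => (∀ r s, ϖ ^ (-((i : ℕ) : ℤ)) * ((((D⁻¹ * ((t.out⁻¹ * γ * t.out : ↥(unitaryGroupOfForm σ (J : Matrix (Fin 2) (Fin 2) F))) : GL (Fin 2) F) * D : GL (Fin 2) F)) : Matrix (Fin 2) (Fin 2) F) - u 1 • (1 : Matrix (Fin 2) (Fin 2) F)) r s ∈ 𝒪[F])) N) m) := by
    intro t ht
    have hkI' := hkI t ht
    have hkO := ((mem_glInt_iff _).1 hkI').1
    have hac : ((((D⁻¹ * ((t.out⁻¹ * γ * t.out : ↥(unitaryGroupOfForm σ (J : Matrix (Fin 2) (Fin 2) F))) : GL (Fin 2) F) * D : GL (Fin 2) F)) : Matrix (Fin 2) (Fin 2) F) - u 0 • 1) *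
        ((((D⁻¹ * ((t.out⁻¹ * γ * t.out : ↥(unitaryGroupOfForm σ (J : Matrix (Fin 2) (Fin 2) F))) : GL (Fin 2) F) * D : GL (Fin 2) F)) : Matrix (Fin 2) (Fin 2) F) - u 1 • 1) = 0 := by
      rw [hconjGL t]
      exact sub_smul_mul_sub_smul_eq_zero_of_conj_diagonal (γ : GL (Fin 2) F) P ((t.out : GL (Fin 2) F) * D) hP
    by_cases hmd : m ≤ Nat.findGreatest (fun i => (∀ r s, ϖ ^ (-((i : ℕ) : ℤ)) * ((((D⁻¹ * ((t.out⁻¹ * γ * t.out : ↥(unitaryGroupOfForm σ (J : Matrix (Fin 2) (Fin 2) F))) : GL (Fin 2) F) * D : GL (Fin 2) F)) : Matrix (Fin 2) (Fin 2) F) - u 1 • (1 : Matrix (Fin 2) (Fin 2) F)) r s ∈ 𝒪[F])) N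
    · simp only [min_eq_right hmd, if_true]
      exact apply_eq_apply_scalar_of_depth_le_conj σ (J : Matrix (Fin 2) (Fin 2) F) D (hu1v 1) m Km hKm φ hφm xm hxm' _
        ((le_findGreatest_iff_of_anti (hanti t) (h0 t ht) hmN).1 hmd)
    · have hlt : Nat.findGreatest (fun i => (∀ r s, ϖ ^ (-((i : ℕ) : ℤ)) * ((((D⁻¹ * ((t.out⁻¹ * γ * t.out : ↥(unitaryGroupOfForm σ (J : Matrix (Fin 2) (Fin 2) F))) : GL (Fin 2) F) * D : GL (Fin 2) F)) : Matrix (Fin 2) (Fin 2) F) - u 1 • (1 : Matrix (Fin 2) (Fin 2) F)) r s ∈ 𝒪[F])) N < m :=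
        not_le.1 hmd
      simp only [min_eq_left hlt.le, if_neg hlt.ne]
      obtain ⟨hki, hki'⟩ := (findGreatest_eq_iff_of_anti (hanti t) (h0 t ht) (lt_of_lt_of_le hlt hmN)).1 rfl
      rw [Nat.cast_succ] at hki'
      -- the eigenline of `k♯` and its `J♯`-value: `ϖ·θ♯ = −h 0`
      have hv : ∀ z : Fin 2 → F, (((D⁻¹ * ((t.out⁻¹ * γ * t.out : ↥(unitaryGroupOfForm σ (J : Matrix (Fin 2) (Fin 2) F))) : GL (Fin 2) F) * D : GL (Fin 2) F)) : Matrix (Fin 2) (Fin 2) F) *ᵥ z = u 0 • z →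
          ∃ ξ : F, z = ξ • fun r => (((((t.out : GL (Fin 2) F) * D)⁻¹ : GL (Fin 2) F) : Matrix (Fin 2) (Fin 2) F) * (P : Matrix (Fin 2) (Fin 2) F)) r 0 := by
        intro z hz
        rw [hconjGL t] at hz
        exact exists_eq_smul_col_of_conj_diagonal_mulVec (γ : GL (Fin 2) F) P ((t.out : GL (Fin 2) F) * D) hP h01 z hz
      have hcongr : Matrix.diagonal h = (-ϖ) • formCongr σ (((t.out : GL (Fin 2) F) * D)⁻¹ * P) (!![0, -1; 1, 0] : Matrix (Fin 2) (Fin 2) F) := by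
        have htU : formCongr σ (t.out : GL (Fin 2) F) (J : Matrix (Fin 2) (Fin 2) F) = (J : Matrix (Fin 2) (Fin 2) F) := mem_unitaryGroupOfForm_iff.1 t.out.2
        have hDJ' : formCongr σ D (J : Matrix (Fin 2) (Fin 2) F) = (-ϖ) • (!![0, -1; 1, 0] : Matrix (Fin 2) (Fin 2) F) := by
          rw [hJ]; exact formCongr_diag_eq_neg_smul_sharp σ D hD hσϖ
        have hsplit : formCongr σ P (J : Matrix (Fin 2) (Fin 2) F) =
            formCongr σ (((t.out : GL (Fin 2) F) * D)⁻¹ * P) (formCongr σ ((t.out : GL (Fin 2) F) * D) (J : Matrix (Fin 2) (Fin 2) F)) := by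
          rw [← UnitaryGroup.formCongr_mul_eq_formCongr_formCongr, mul_inv_cancel_left]
        rw [← hPh, hsplit, UnitaryGroup.formCongr_mul_eq_formCongr_formCongr σ (t.out : GL (Fin 2) F) D, htU, hDJ', UnitaryGroup.formCongr_smul_right]
      have hθeq : ϖ * ((fun r => σ ((((((t.out : GL (Fin 2) F) * D)⁻¹ : GL (Fin 2) F) : Matrix (Fin 2) (Fin 2) F) * (P : Matrix (Fin 2) (Fin 2) F)) r 0)) ⬝ᵥ
            (!![0, -1; 1, 0] *ᵥ fun r => (((((t.out : GL (Fin 2) F) * D)⁻¹ : GL (Fin 2) F) : Matrix (Fin 2) (Fin 2) F) * (P : Matrix (Fin 2) (Fin 2) F)) r 0)) = -h 0 := by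
        have h00 := congr_fun (congr_fun hcongr 0) 0
        rw [Matrix.diagonal_apply_eq, Matrix.smul_apply, smul_eq_mul] at h00
        rw [pairing_col_eq_conjTranspose_mul_apply, h00, formCongr, Units.val_mul, neg_mul, neg_neg]
      have hθ1 : valuation F (ϖ * ((fun r => σ ((((((t.out : GL (Fin 2) F) * D)⁻¹ : GL (Fin 2) F) : Matrix (Fin 2) (Fin 2) F) * (P : Matrix (Fin 2) (Fin 2) F)) r 0)) ⬝ᵥ
            (!![0, -1; 1, 0] *ᵥ fun r => (((((t.out : GL (Fin 2) F) * D)⁻¹ : GL (Fin 2) F) : Matrix (Fin 2) (Fin 2) F) * (P : Matrix (Fin 2) (Fin 2) F)) r 0))) = 1 := by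
        rw [hθeq, Valuation.map_neg]; exact hh0
      obtain ⟨heven, -, hall⟩ := apply_eq_apply_signedNormalForm_of_depth_eq_ramified_modular σ hϖ hσϖ σO hσO hσσ (J : Matrix (Fin 2) (Fin 2) F) hJ D hD h2 hres hηu hση hη
        (hu1 0) (hu1 1) (hu1v 0) (hu1v 1) hN hlt hmN Km hKm φ (fun κ hκ y => hφAd κ ((Subgroup.mem_subgroupOf).2 hκ) y) hφm x' hx'' _ hkO hac hki hki' _ hv hθ1
      obtain ⟨e', he', hiff', hval⟩ := hall (S _) (by rw [hθeq])
      have hee : e' = e _ := eq_of_iff_eq_zero_of_le_one_vtx (he1 _) he' (hechar _) hiff'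
      rw [hval, hee]
  -- §f the counts: cosets ↦ `ϖ`-modular lattices (★ V1 + docking (hB)), token bridge to `ϖ^{−1} • J₀`, frame transport to `S(ϖ^{−1} • diag h, diag u)`, ★ R2-C at `d = 1`
  have hDJ : ∃ J' ∈ glInt 2 F, ϖ • (J' : Matrix (Fin 2) (Fin 2) F) = formCongr σ D (J : Matrix (Fin 2) (Fin 2) F) := by
    rw [hJ]; exact exists_mem_glInt_smul_coe_eq_formCongr_diag σ D hD hσϖ
  have hcount : ∀ X : Submodule 𝒪[F] (Fin 2 → F) → Prop, ∀ Y : (↥(unitaryGroupOfForm σ (J : Matrix (Fin 2) (Fin 2) F)) ⧸ ((glInt 2 F).map (MulAut.conj D).toMonoidHom).subgroupOf (unitaryGroupOfForm σ (J : Matrix (Fin 2) (Fin 2) F))) → Prop,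
      (∀ t ∈ MulAction.fixedBy (↥(unitaryGroupOfForm σ (J : Matrix (Fin 2) (Fin 2) F)) ⧸ ((glInt 2 F).map (MulAut.conj D).toMonoidHom).subgroupOf (unitaryGroupOfForm σ (J : Matrix (Fin 2) (Fin 2) F))) γ,
        Y t ↔ X (Submodule.span 𝒪[F] (Set.range (((((t.out : ↥(unitaryGroupOfForm σ (J : Matrix (Fin 2) (Fin 2) F))) : GL (Fin 2) F) * D : GL (Fin 2) F) : Matrix (Fin 2) (Fin 2) F))ᵀ))) →
      {t ∈ MulAction.fixedBy (↥(unitaryGroupOfForm σ (J : Matrix (Fin 2) (Fin 2) F)) ⧸ ((glInt 2 F).map (MulAut.conj D).toMonoidHom).subgroupOf (unitaryGroupOfForm σ (J : Matrix (Fin 2) (Fin 2) F))) γ | Y t}.ncard =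
        {Λ : Submodule 𝒪[F] (Fin 2 → F) |
          ((∃ g : GL (Fin 2) F, (∃ J' ∈ glInt 2 F, (J' : Matrix (Fin 2) (Fin 2) F) = formCongr σ g (ϖ⁻¹ • (J : Matrix (Fin 2) (Fin 2) F))) ∧
              Λ = Submodule.span 𝒪[F] (Set.range ((g : Matrix (Fin 2) (Fin 2) F))ᵀ)) ∧
            Λ.map ((Matrix.toLin' ((((γ : ↥(unitaryGroupOfForm σ (J : Matrix (Fin 2) (Fin 2) F))) : GL (Fin 2) F) : Matrix (Fin 2) (Fin 2) F))).restrictScalars 𝒪[F]) = Λ) ∧ X Λ}.ncard := by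
    intro X Y hXY
    rw [ncard_sep_fixedBy_conj_unitary_eq_ncard_modular σ J D γ hDJ hB X Y hXY,
      setOf_modularStable_and_eq_selfDualStable_and σ hϖ0 (J : Matrix (Fin 2) (Fin 2) F) (γ : GL (Fin 2) F) X]
  -- the transported element `γ' := P⁻¹ γ P` is `diag(u)`
  have hγ' : (((P⁻¹ * (γ : GL (Fin 2) F) * P : GL (Fin 2) F)) : Matrix (Fin 2) (Fin 2) F) = !![u 0, 0; 0, u 1] := by
    rw [Units.val_mul, Units.val_mul, Matrix.mul_assoc, hP, ← Matrix.mul_assoc, ← Units.val_mul, inv_mul_cancel, Units.val_one, Matrix.one_mul, diagonal_fin_two_eq_vtx]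
  have hform : formCongr σ P (ϖ⁻¹ • (J : Matrix (Fin 2) (Fin 2) F)) = ϖ ^ (-((1 : ℕ) : ℤ)) • Matrix.diagonal h := by
    rw [UnitaryGroup.formCongr_smul_right, hPh, Nat.cast_one, _root_.zpow_neg_one]
  have htransport : ∀ (s : F) (i : ℕ),
      {Λ : Submodule 𝒪[F] (Fin 2 → F) |
          ((∃ g : GL (Fin 2) F, (∃ J' ∈ glInt 2 F, (J' : Matrix (Fin 2) (Fin 2) F) = formCongr σ g (ϖ⁻¹ • (J : Matrix (Fin 2) (Fin 2) F))) ∧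
              Λ = Submodule.span 𝒪[F] (Set.range ((g : Matrix (Fin 2) (Fin 2) F))ᵀ)) ∧
            Λ.map ((Matrix.toLin' ((((γ : ↥(unitaryGroupOfForm σ (J : Matrix (Fin 2) (Fin 2) F))) : GL (Fin 2) F) : Matrix (Fin 2) (Fin 2) F))).restrictScalars 𝒪[F]) = Λ) ∧
          Λ.map ((Matrix.toLin' ((((γ : ↥(unitaryGroupOfForm σ (J : Matrix (Fin 2) (Fin 2) F))) : GL (Fin 2) F) : Matrix (Fin 2) (Fin 2) F) - s • (1 : Matrix (Fin 2) (Fin 2) F))).restrictScalars 𝒪[F]) ≤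
            Λ.map ((Matrix.toLin' (ϖ ^ i • (1 : Matrix (Fin 2) (Fin 2) F))).restrictScalars 𝒪[F])}.ncard =
      {Λ : Submodule 𝒪[F] (Fin 2 → F) |
          ((∃ g : GL (Fin 2) F, (∃ J' ∈ glInt 2 F, (J' : Matrix (Fin 2) (Fin 2) F) = formCongr σ g (ϖ ^ (-((1 : ℕ) : ℤ)) • Matrix.diagonal h)) ∧
              Λ = Submodule.span 𝒪[F] (Set.range ((g : Matrix (Fin 2) (Fin 2) F))ᵀ)) ∧
            Λ.map ((Matrix.toLin' (((P⁻¹ * (γ : GL (Fin 2) F) * P : GL (Fin 2) F)) : Matrix (Fin 2) (Fin 2) F)).restrictScalars 𝒪[F]) = Λ) ∧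
          Λ.map ((Matrix.toLin' ((((P⁻¹ * (γ : GL (Fin 2) F) * P : GL (Fin 2) F)) : Matrix (Fin 2) (Fin 2) F) - s • (1 : Matrix (Fin 2) (Fin 2) F))).restrictScalars 𝒪[F]) ≤
            Λ.map ((Matrix.toLin' (ϖ ^ i • (1 : Matrix (Fin 2) (Fin 2) F))).restrictScalars 𝒪[F])}.ncard := by
    intro s i
    rw [ncard_selfDualStable_level_congr σ (ϖ⁻¹ • (J : Matrix (Fin 2) (Fin 2) F)) (γ : GL (Fin 2) F) P s (ϖ ^ i), hform]
  -- the level-`i` counts, `i ≤ N`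
  have hlevel : ∀ i : ℕ, i ≤ N → {t ∈ MulAction.fixedBy (↥(unitaryGroupOfForm σ (J : Matrix (Fin 2) (Fin 2) F)) ⧸ ((glInt 2 F).map (MulAut.conj D).toMonoidHom).subgroupOf (unitaryGroupOfForm σ (J : Matrix (Fin 2) (Fin 2) F))) γ |
      i ≤ Nat.findGreatest (fun i => (∀ r s, ϖ ^ (-((i : ℕ) : ℤ)) * ((((D⁻¹ * ((t.out⁻¹ * γ * t.out : ↥(unitaryGroupOfForm σ (J : Matrix (Fin 2) (Fin 2) F))) : GL (Fin 2) F) * D : GL (Fin 2) F)) : Matrix (Fin 2) (Fin 2) F) - u 1 • (1 : Matrix (Fin 2) (Fin 2) F)) r s ∈ 𝒪[F])) N}.ncard =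
      ∑ j ∈ (range (N + 1)).filter (fun j => j % 2 = 1 ∧ j + i ≤ N), (if j = 0 then 1 else 2 * q ^ (j / 2)) := by
    intro i hiN
    have hlev := ncard_selfDualStable_zpow_smul_diagonal_level_eq_sum hϖ σO hσO hσσ hres h2 hσϖ hh0 hh1 hσh r hr hsq (d := 1) le_rfl
      (P⁻¹ * (γ : GL (Fin 2) F) * P) hγ' (hu1v 0) (hu1v 1) hN hq (s := u 1) (i := i)
      (by have epow : (ϖ : F) ^ (-(i : ℤ)) * ϖ ^ N = ϖ ^ (N - i) := by
            rw [← zpow_natCast ϖ N, ← zpow_add₀ hϖ0, show (-(i : ℤ) + ((N : ℕ) : ℤ)) = ((N - i : ℕ) : ℤ) by rw [Nat.cast_sub hiN]; ring, zpow_natCast]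
          rw [hwdec, ← mul_assoc, epow]
          exact mul_mem (pow_mem hϖ.mem _) hwO)
      (by rw [sub_self, mul_zero]; exact zero_mem _)
    rw [← hlev, ← htransport (u 1) i]
    refine hcount _ _ fun t ht => ?_
    rw [le_findGreatest_iff_of_anti (hanti t) (h0 t ht) hiN, map_sub_smul_one_le_iff_forall_mem hϖ0 (γ : GL (Fin 2) F) ((t.out : GL (Fin 2) F) * D) (u 1) i, hconjGL t]
  have hsetm := hlevel m hmN
  -- the exact-depth counts: level `i` minus level `i + 1`
  have hseti : ∀ i, i < m → {t ∈ MulAction.fixedBy (↥(unitaryGroupOfForm σ (J : Matrix (Fin 2) (Fin 2) F)) ⧸ ((glInt 2 F).map (MulAut.conj D).toMonoidHom).subgroupOf (unitaryGroupOfForm σ (J : Matrix (Fin 2) (Fin 2) F))) γ |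
      Nat.findGreatest (fun i => (∀ r s, ϖ ^ (-((i : ℕ) : ℤ)) * ((((D⁻¹ * ((t.out⁻¹ * γ * t.out : ↥(unitaryGroupOfForm σ (J : Matrix (Fin 2) (Fin 2) F))) : GL (Fin 2) F) * D : GL (Fin 2) F)) : Matrix (Fin 2) (Fin 2) F) - u 1 • (1 : Matrix (Fin 2) (Fin 2) F)) r s ∈ 𝒪[F])) N = i}.ncard =
      (if i ≤ N ∧ (N - i) % 2 = 1 then (if N - i = 0 then 1 else 2 * q ^ ((N - i) / 2)) else 0) := by
    intro i him
    have hiN : i + 1 ≤ N := by omega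
    have hsub : {t ∈ MulAction.fixedBy (↥(unitaryGroupOfForm σ (J : Matrix (Fin 2) (Fin 2) F)) ⧸ ((glInt 2 F).map (MulAut.conj D).toMonoidHom).subgroupOf (unitaryGroupOfForm σ (J : Matrix (Fin 2) (Fin 2) F))) γ |
        i + 1 ≤ Nat.findGreatest (fun i => (∀ r s, ϖ ^ (-((i : ℕ) : ℤ)) * ((((D⁻¹ * ((t.out⁻¹ * γ * t.out : ↥(unitaryGroupOfForm σ (J : Matrix (Fin 2) (Fin 2) F))) : GL (Fin 2) F) * D : GL (Fin 2) F)) : Matrix (Fin 2) (Fin 2) F) - u 1 • (1 : Matrix (Fin 2) (Fin 2) F)) r s ∈ 𝒪[F])) N} ⊆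
        {t ∈ MulAction.fixedBy (↥(unitaryGroupOfForm σ (J : Matrix (Fin 2) (Fin 2) F)) ⧸ ((glInt 2 F).map (MulAut.conj D).toMonoidHom).subgroupOf (unitaryGroupOfForm σ (J : Matrix (Fin 2) (Fin 2) F))) γ |
        i ≤ Nat.findGreatest (fun i => (∀ r s, ϖ ^ (-((i : ℕ) : ℤ)) * ((((D⁻¹ * ((t.out⁻¹ * γ * t.out : ↥(unitaryGroupOfForm σ (J : Matrix (Fin 2) (Fin 2) F))) : GL (Fin 2) F) * D : GL (Fin 2) F)) : Matrix (Fin 2) (Fin 2) F) - u 1 • (1 : Matrix (Fin 2) (Fin 2) F)) r s ∈ 𝒪[F])) N} :=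
      fun t ht => ⟨ht.1, (Nat.le_succ i).trans ht.2⟩
    have heq : {t ∈ MulAction.fixedBy (↥(unitaryGroupOfForm σ (J : Matrix (Fin 2) (Fin 2) F)) ⧸ ((glInt 2 F).map (MulAut.conj D).toMonoidHom).subgroupOf (unitaryGroupOfForm σ (J : Matrix (Fin 2) (Fin 2) F))) γ |
        Nat.findGreatest (fun i => (∀ r s, ϖ ^ (-((i : ℕ) : ℤ)) * ((((D⁻¹ * ((t.out⁻¹ * γ * t.out : ↥(unitaryGroupOfForm σ (J : Matrix (Fin 2) (Fin 2) F))) : GL (Fin 2) F) * D : GL (Fin 2) F)) : Matrix (Fin 2) (Fin 2) F) - u 1 • (1 : Matrix (Fin 2) (Fin 2) F)) r s ∈ 𝒪[F])) N = i} =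
        {t ∈ MulAction.fixedBy (↥(unitaryGroupOfForm σ (J : Matrix (Fin 2) (Fin 2) F)) ⧸ ((glInt 2 F).map (MulAut.conj D).toMonoidHom).subgroupOf (unitaryGroupOfForm σ (J : Matrix (Fin 2) (Fin 2) F))) γ |
          i ≤ Nat.findGreatest (fun i => (∀ r s, ϖ ^ (-((i : ℕ) : ℤ)) * ((((D⁻¹ * ((t.out⁻¹ * γ * t.out : ↥(unitaryGroupOfForm σ (J : Matrix (Fin 2) (Fin 2) F))) : GL (Fin 2) F) * D : GL (Fin 2) F)) : Matrix (Fin 2) (Fin 2) F) - u 1 • (1 : Matrix (Fin 2) (Fin 2) F)) r s ∈ 𝒪[F])) N} \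
        {t ∈ MulAction.fixedBy (↥(unitaryGroupOfForm σ (J : Matrix (Fin 2) (Fin 2) F)) ⧸ ((glInt 2 F).map (MulAut.conj D).toMonoidHom).subgroupOf (unitaryGroupOfForm σ (J : Matrix (Fin 2) (Fin 2) F))) γ |
          i + 1 ≤ Nat.findGreatest (fun i => (∀ r s, ϖ ^ (-((i : ℕ) : ℤ)) * ((((D⁻¹ * ((t.out⁻¹ * γ * t.out : ↥(unitaryGroupOfForm σ (J : Matrix (Fin 2) (Fin 2) F))) : GL (Fin 2) F) * D : GL (Fin 2) F)) : Matrix (Fin 2) (Fin 2) F) - u 1 • (1 : Matrix (Fin 2) (Fin 2) F)) r s ∈ 𝒪[F])) N} := by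
      ext t
      simp only [Set.mem_sdiff, Set.mem_setOf_eq, not_and, not_le]
      constructor
      · rintro ⟨ht, h⟩; exact ⟨⟨ht, h.ge⟩, fun _ => by omega⟩
      · rintro ⟨⟨ht, h1⟩, h2⟩; exact ⟨ht, by have := h2 ht; omega⟩
    have hsplit := Set.ncard_sdiff_add_ncard_of_subset hsub (hfin.subset fun t ht => ht.1)
    rw [hlevel i (by omega), hlevel (i + 1) hiN, sum_filter_mod_two_add_le_eq _ N 1 i] at hsplit
    rw [heq]
    omega
  -- §g ★ (α) L1: regroup the fixed-point sum by `min (depth t) m`, then substitute the counts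
  rw [finsum_mem_eq_ncard_smul_add_sum_ncard_smul hfin (fun t => φ (t.out⁻¹ * γ * t.out))
    (fun t => Nat.findGreatest (fun i => (∀ r s, ϖ ^ (-((i : ℕ) : ℤ)) * ((((D⁻¹ * ((t.out⁻¹ * γ * t.out : ↥(unitaryGroupOfForm σ (J : Matrix (Fin 2) (Fin 2) F))) : GL (Fin 2) F) * D : GL (Fin 2) F)) : Matrix (Fin 2) (Fin 2) F) - u 1 • (1 : Matrix (Fin 2) (Fin 2) F)) r s ∈ 𝒪[F])) N) m
    (fun j : ℕ => if j = m then φ xm else φ (x' j (e j))) hvalue, if_pos rfl, hsetm]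
  congr 1
  refine Finset.sum_congr rfl fun i hi => ?_
  have him : i < m := Finset.mem_range.1 hi
  rw [if_neg him.ne, hseti i him]

end Expansion

end Literature.NumberTheory.Automorphic

end
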